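import Summits.BirchSwinnertonDyer.BirchSwinnertonDyer.Theorems.AdditiveBranchIMCGordTwoRankOneHeegnerKolyvaginTwist
import Summits.BirchSwinnertonDyer.Rank1Residual.X11b.BDPRouteManin
import Summits.BirchSwinnertonDyer.Rank1Residual.Additive.GordManinConstant
import Summits.BirchSwinnertonDyer.Rank1Residual.Additive.GordIsogenyInvariance
import Summits.BirchSwinnertonDyer.Rank1Residual.Additive.N10LowerHalfStatements
import Literature.NumberTheory.EllipticCurves.KolyvaginShaStructureAnyLevel
import Literature.NumberTheory.EllipticCurves.IsogenyConductorModularityProofs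
import HarnessLib

/-!
# Route `AdditiveBranchIMC` (rung K1), crux `GordTwoRankOne` (item 19358): the HEIGHT-FREE
# Heegner–Kolyvagin road — Jetchev–Skinner–Wan 2017 §7.4.1 run at an ADDITIVE prime. Part 2: the
# per-pair Kolyvagin certificate, the Manin-unit datum at `p ≥ 11`, and the class-level theorem
# (cell `bsd-addord`, second prover lane `bsd-addord-k1-c3x`, gen 0; `--supports` only)

HONEST FRAMING. THEOREMS ONLY: no definition, no new named fact, no `sorry`; nothing is booked; BSD is
not proved by any of this; the crux stays OPEN at class level. Part 1 (`…HeegnerKolyvaginTwist.lean`)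
proved the pointwise LOWER half `ord_p #Ш(E)_an ≤ ord_p #Ш(E)` for a rank-one curve at an additive
potentially good prime from PUBLISHED facts + the STEP-L-shaped input `X11b.IndexLowerBoundAt W p K P`
("`2·ord_p[E(K):ℤP] ≤ ord_p #Ш(E/K) + 2·ord_p ∏c_ℓ(E)`", the typed open input of route X11b, here at
`p² ∣ N`). This file:

* §3 the PER-PAIR supplier of STEP L_add: the published, reduction-agnostic theorem of Kolyvagin
  (McCallum 1991 §1 / §5: ONE derived Heegner point `P_n ∉ pE(K_n)` at a square-free Kolyvagin level
  `n` gives `#Ш(E/K)[p^∞] = p^{2M₀}`; tree fact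
  `McCallum1991_card_sha_primary_baseChange_of_derivedPoint_not_divisible_anyLevel`) —
  `indexLowerBoundAt_of_anyLevelCertificate`; and the resulting door
  `missingLowerBoundAt_rankOne_additive_of_anyLevelCertificate` — the rank-ONE twin of the tree's
  rank-zero `Additive.ClassX4.missingLowerBoundAt_rankZero_of_derivedCertificate`, reaching the CONTENT
  window `p ∣ #Ш(E)_an` (where the level `n` must be composite: McCallum Thm 5.4, `N₂ = M₁ − M₂`).
* §4 the Manin-unit Heegner datum on the cell at `p ≥ 11`: Edixhoven 1991 Thm 3 (Kodaira `I₀*` lies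
  outside the exception "(G)-ordinary of type II, III, IV"; tree reading
  `Addv.not_dvd_maninConstant_of_semistabilityIndex_dvd_two`) in place of Mazur 1978 Cor. 4.1 (which
  needs `p² ∤ N`) — `exists_maninDatum_of_cellGordTwo`.
* §5 CLASS LEVEL: `cellGordTwo_missingLowerBoundAt_rankOne_of_towerSurj_of_indexLowerBoundAt` — for every
  globally minimal `E/ℚ` with `ord_{s=1}L(E,s) = 1` and every pair of cell (G-ord, `e = 2`) with
  `ρ̄_{E,p^n}` onto for all `n`: `Typed.MissingLowerBoundAt W p`, from PUBLISHED facts (Gross–Zagier,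
  Kolyvagin, Kato 14.5 (3) Tamagawa-exact, GZK, modularity, Friedberg–Hoffstein, Edixhoven, Néron) + STEP
  L_add at every Manin-good Heegner datum (`hL`, OPEN, displayed) + at `p ≤ 7` a Manin-unit datum
  (`hMan7`, rider). The crux BY NAME with the complementary rows displayed is Part 3
  (`…HeegnerKolyvaginByName.lean`).
WHAT THE OPEN INPUT IS, in print elsewhere: "one divisibility of the anticyclotomic main conjecture + the
BDP `p`-adic Waldspurger formula" (JSW 2017 §7.4.1, good `p`) or W. Zhang 2014's `p`-indivisibility of the
Heegner-point Kolyvagin system (`M_∞ = 0` under `p ∤ ∏c_ℓ`; good ordinary `p`; Sweeting 2020, BCGS 2023: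
`p ∤ N`) — neither at an additive prime. Zhang's induction needs only the RANK-ZERO Eisenstein direction
for level-raised forms + Bertolini–Darmon level raising: on this road the rank-one crux asks for no
`p`-adic Gross–Zagier formula on the branch and no `p`-adic height.

References: [McCallumLMS1991] §1, §5; [JetchevSkinnerWan2017] §7.4.1; [Kato2004Asterisque] Thm 14.5 (3);
[EdixhovenManin1991] Thm 3; [FriedbergHoffstein1995]; [WZhang2014CambJMath] Thm 1.1; [Miller2011LMS] Def 1.1.
-/

set_option autoImplicit false
set_option linter.dupNamespace false
noncomputable section

open scoped Classical NumberField
open WeierstrassCurve NumberField IsDedekindDomain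
  Literature.NumberTheory.EllipticCurves Literature.NumberTheory.EllipticCurves.ModularForms
  Literature.NumberTheory.EllipticCurves.Rank1Residual
  Literature.NumberTheory.EllipticCurves.Rank1Residual.Typed
  Summit.BirchSwinnertonDyer.Rank1Residual
  Summit.BirchSwinnertonDyer.Rank1Residual.Additive
  Summit.BirchSwinnertonDyer.Rank1Residual.X11b
  Summit.BirchSwinnertonDyer.Rank1Residual.GaloisImage
  Literature.NumberTheory.Automorphic

namespace Summit.BirchSwinnertonDyer.BirchSwinnertonDyer.Theorems.AdditiveBranchIMCGordTwoRankOne.HeegnerKolyvagin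

/-! ### §3 The per-pair supplier of STEP L_add: ONE non-divisible derived Heegner point of any
square-free Kolyvagin level (Kolyvagin 1991 / McCallum 1991 §1 — reduction-agnostic, PUBLISHED) -/

/-- **STEP L at the pair from a McCallum any-level certificate.** Under the named fact
`McCallum1991_card_sha_primary_baseChange_of_derivedPoint_not_divisible_anyLevel` (`hKoAny`; McCallum 1991
§1 Theorem with §5 Lemma 5.1 / Cor. 5.6: `#Ш(E/K)[p^∞] = p^{2M₀}` from ONE derived point `P_n ∉ pE(K_n)` at a
square-free level `n` all of whose prime factors are Kolyvagin primes; NO hypothesis on the reduction of `E`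
at `p`) and its hypotheses (no CM; `K` imaginary quadratic, Heegner for `N`, `d_K ∉ {−3,−4}`; `p` odd with
`ρ̄_{E,p^k}` onto for all `k`; the conductor-`1` datum `d₁` with `y_K = P_1` of infinite order and
`p^{M₀} ∥ y_K` in `E(K_1)`; the level-`n` certificate), together with the Heegner point `P ∈ E(K)` and the
Lemma-5.1 link `ord_p [E(K):ℤP] ≤ M₀` (McCallum Lemma 5.1: `M₀ = ord_p[E(K):ℤy_K]`; carried per pair as the
datum `hIM`): `2·ord_p[E(K):ℤP] ≤ ord_p #Ш(E/K) + 2·ord_p ∏c_ℓ(E)` (`X11b.IndexLowerBoundAt W p K P`), granted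
finiteness of `Ш(E/K)`. On the CONTENT window of the crux (`p ∣ #Ш(E)_an`, so `M₁ ≥ 1`) the level `n` is
necessarily composite (McCallum Thm. 5.4: `N₂ = M₁ − M₂`). [cite: McCallumLMS1991, §1 Theorem (Kolyvagin) (p. 296); §5 Lemma 5.1, Thm. 5.4, Cor. 5.6]
[cite: JetchevSkinnerWan2017, §7.4.1 (eq:shalowerK-1), p. 30] -/
theorem indexLowerBoundAt_of_anyLevelCertificate
    (hKoAny : McCallum1991_card_sha_primary_baseChange_of_derivedPoint_not_divisible_anyLevel)
    (W : WeierstrassCurve ℚ) [W.IsElliptic] [W.IsGloballyMinimal] [NeZero (W.conductorNorm ℤ)]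
    (p : ℕ) [Fact p.Prime] (K : Type) [Field K] [NumberField K]
    (hCM : ¬ W.HasCM) (hK : IsImaginaryQuadratic K) (hD3 : NumberField.discr K ≠ -3)
    (hD4 : NumberField.discr K ≠ -4) (hH : SatisfiesHeegnerHypothesis (W.conductorNorm ℤ) K)
    (hp2 : p ≠ 2) (htower : ∀ k : ℕ, W.HasSurjectiveModNGaloisRep (p ^ k : ℕ))
    (Dt : ModularParametrizationData W (W.conductorNorm ℤ)) (β : ℤ) (ι : K →+* ℂ)
    (d₁ : KolyvaginHeegnerData Dt β ι 1) (hy : ¬ IsOfFinAddOrder d₁.derivedPoint) (M₀ : ℕ)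
    (hdiv : ∃ Q : (W.baseChange (ringClassField K ι 1)).toAffine.Point,
      ((p ^ M₀ : ℕ) : ℤ) • Q = d₁.derivedPoint)
    (hndiv : ¬ ∃ Q : (W.baseChange (ringClassField K ι 1)).toAffine.Point,
      ((p ^ (M₀ + 1) : ℕ) : ℤ) • Q = d₁.derivedPoint)
    (n : ℕ) (d : KolyvaginHeegnerData Dt β ι n) (hn : Squarefree n)
    (hKoly : ∀ ℓ ∈ n.primeFactors, Zhang2014.IsKolyvaginPrime (W.conductorNorm ℤ) W K p ℓ)
    (hP : ¬ ∃ Q : (W.baseChange (ringClassField K ι n)).toAffine.Point, (p : ℤ) • Q = d.derivedPoint)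
    (P : (W.baseChange K).toAffine.Point)
    (hIM : padicValNat p (AddSubgroup.zmultiples P).index ≤ M₀)
    (hfin : Finite (W.baseChange K).sha) : IndexLowerBoundAt W p K P := by
  have hcard := hKoAny W hCM K hK hD3 hD4 hH p hp2 htower Dt β ι d₁ hy M₀ hdiv hndiv n d hn hKoly hP
  haveI := hfin
  have hsha : padicValNat p (W.baseChange K).shaOrder = 2 * M₀ := by
    rw [WeierstrassCurve.shaOrder, ← padicValNat_card_addPrimaryComponent (A := (W.baseChange K).sha) p,
      hcard, padicValNat.prime_pow]
  unfold IndexLowerBoundAt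
  rw [hsha]
  omega

/-- **THE PER-PAIR DOOR on the content window: the crux's lower half at an additive potentially good prime of
a rank-one curve from PUBLISHED facts + ONE Kolyvagin certificate.** Data and published binders as in
`missingLowerBoundAt_rankOne_additive_of_indexLowerBoundAt` (`hGZ`, `hKo`, `hKatoT`, `hGZK`, `hmod`) plus
McCallum's any-level fact `hKoAny` with its certificate data (`d₁`, `M₀`, the level-`n` derived point
`P_n ∉ pE(K_n)`) and the Lemma-5.1 link `hIM`; `d_K ∉ {−3,−4}`, no CM. CONCLUSION:
`Typed.MissingLowerBoundAt W p` — `ord_p #Ш(E)_an ≤ ord_p #Ш(E)` — with NO typed input: every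
non-published ingredient is a finite certificate about Heegner points (the instrument question of the
lane: derived points modulo `p`, à la Jetchev–Lauter–Stein 2009). The rank-ONE twin of the tree's rank-zero
`Additive.ClassX4.missingLowerBoundAt_rankZero_of_derivedCertificate`, reaching the rows `p ∣ #Ш(E)_an`
that no `#Ш_an`-unit datum / index record reaches. [cite: McCallumLMS1991, §1 Theorem (Kolyvagin) (p. 296)]
[cite: JetchevSkinnerWan2017, §7.4.1 (pp. 29–31)] [cite: Kato2004Asterisque, Thm. 14.5 (3) (p. 236)] -/
theorem missingLowerBoundAt_rankOne_additive_of_anyLevelCertificate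
    (W : WeierstrassCurve ℚ) [W.IsElliptic] [W.IsGloballyMinimal] (p : ℕ) [Fact p.Prime]
    [NeZero (W.conductorNorm ℤ)] (K : Type) [Field K] [NumberField K]
    (Dt : ModularParametrizationData W (W.conductorNorm ℤ))
    (H : HeegnerDatum (W.conductorNorm ℤ) (NumberField.discr K)) (ι : K →+* ℂ)
    (P : (W.baseChange K).toAffine.Point)
    -- the published inputs (named facts of the tree)
    (hGZ : gross_zagier (W.conductorNorm ℤ) W K) (hKo : kolyvagin (W.conductorNorm ℤ) W K)
    (hKatoT : Kato2004.rankZero_padicValNat_sha_add_padicValNat_tamagawa_le_of_additive_potGood_of_imageContainsSL2)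
    (hKoAny : McCallum1991_card_sha_primary_baseChange_of_derivedPoint_not_divisible_anyLevel)
    (hGZK : rank_eq_analyticRank_of_analyticRank_le_one) (hmod : hasEntireLFunction_rat)
    -- the pair
    (hr : W.analyticRank = 1) (hp2 : p ≠ 2) (hadd : Addv W p) (hj : 0 ≤ padicValRat p W.j)
    (hsurj : ∀ n : ℕ, W.HasSurjectiveModNGaloisRep (p ^ n : ℕ)) (hCM : ¬ W.HasCM)
    -- the Heegner data
    (hK : IsImaginaryQuadratic K) (hD3 : NumberField.discr K ≠ -3) (hD4 : NumberField.discr K ≠ -4)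
    (hHN : SatisfiesHeegnerHypothesis (W.conductorNorm ℤ) K)
    (hPt : WeierstrassCurve.Affine.Point.map ι.toRatAlgHom P = heegnerPointComplex Dt H)
    (hc : ¬ (p : ℤ) ∣ Dt.c) (hμ : ¬ p ∣ Units.torsionOrder K)
    (hLt : (W.quadraticTwist (NumberField.discr K : ℚ)).entireLFunction 1 ≠ 0)
    (Wd : WeierstrassCurve ℚ) [Wd.IsElliptic] [Wd.IsGloballyMinimal] (Cd : VariableChange ℚ)
    (hWd : Cd • W.quadraticTwist (NumberField.discr K : ℚ) = Wd)
    -- the Kolyvagin certificate (McCallum §4–§5)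
    (β : ℤ) (d₁ : KolyvaginHeegnerData Dt β ι 1) (hy : ¬ IsOfFinAddOrder d₁.derivedPoint) (M₀ : ℕ)
    (hdiv : ∃ Q : (W.baseChange (ringClassField K ι 1)).toAffine.Point,
      ((p ^ M₀ : ℕ) : ℤ) • Q = d₁.derivedPoint)
    (hndiv : ¬ ∃ Q : (W.baseChange (ringClassField K ι 1)).toAffine.Point,
      ((p ^ (M₀ + 1) : ℕ) : ℤ) • Q = d₁.derivedPoint)
    (n : ℕ) (d : KolyvaginHeegnerData Dt β ι n) (hn : Squarefree n)
    (hKoly : ∀ ℓ ∈ n.primeFactors, Zhang2014.IsKolyvaginPrime (W.conductorNorm ℤ) W K p ℓ)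
    (hPn : ¬ ∃ Q : (W.baseChange (ringClassField K ι n)).toAffine.Point, (p : ℤ) • Q = d.derivedPoint)
    (hIM : padicValNat p (AddSubgroup.zmultiples P).index ≤ M₀) :
    Typed.MissingLowerBoundAt W p :=
  missingLowerBoundAt_rankOne_additive_of_indexLowerBoundAt W p K Dt H ι P hGZ hKo hKatoT hGZK hmod hr hp2
    hadd hj hsurj hK hHN hPt hc hμ hLt Wd Cd hWd fun hfin ↦
      indexLowerBoundAt_of_anyLevelCertificate hKoAny W p K hCM hK hD3 hD4 hHN hp2 hsurj Dt β ι d₁ hy M₀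
        hdiv hndiv n d hn hKoly hPn P hIM hfin

/-! ### §4 The Manin-unit Heegner datum on the cell at `p ≥ 11` (Edixhoven 1991 Thm. 3: Kodaira `I₀*` is
outside the exception "(G)-ordinary of type II, III, IV") -/

/-- **A datum of `E` at its conductor level with Manin constant prime to `p`, for a pair of cell (G-ord,
`e = 2`) at `p ≥ 11` with `E[p]` irreducible** — x11b's `exists_modularParametrizationData_not_dvd` with
Mazur 1978 Cor. 4.1 (`p² ∤ N`, which FAILS at an additive `p`) replaced by **Edixhoven 1991 Thm. 3**
(`hEdxK`, read on the cell by the tree's `Addv.not_dvd_maninConstant_of_semistabilityIndex_dvd_two`: at an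
additive `p > 7` of Kodaira type `I₀*` the strong curve has `p ∤ c`). Inputs: Modularity (`hnf`: the optimal
curve `W₀ ~ W` with its datum of minimal degree; `hmodP`: the conductor is an isogeny invariant), Edixhoven
(`hEdxK`), the Néron mapping property (`hNS`, an integral multiplier `Λ_{W₀} → Λ_W` prime to `p`,
`X11b.exists_int_mul_mem_lattice_not_dvd`); the cell is an isogeny invariant (`N10.cellGordTwo_of_isIsogenous`),
so `W₀` is again additive of type `I₀*` at `p`. [cite: EdixhovenManin1991, Thm. 3]
[cite: AgasheRibetStein2006, Thm. 2.6 and §2] [cite: SilvermanATAEC1994, IV.5.1 with IV.6.1 and Cor. IV.9.1] -/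
theorem exists_modularParametrizationData_not_dvd_of_cellGordTwo (hnf : exists_isNewformOf)
    (hmodP : nonempty_modularParametrizationData)
    (hEdxK : edixhoven_not_dvd_maninConstant_of_kodairaSymbol_ne)
    (hNS : integral_neronScaling_of_isGloballyMinimal)
    (W : WeierstrassCurve ℚ) [W.IsElliptic] [W.IsGloballyMinimal] [NeZero (W.conductorNorm ℤ)]
    (p : ℕ) [Fact p.Prime] (hc2 : N10.CellGordTwo W p) (hp7 : 7 < p)
    (hirr : W.HasIrreducibleModPGaloisRep p) :
    ∃ Dt : ModularParametrizationData W (W.conductorNorm ℤ), ¬ (p : ℤ) ∣ Dt.c := by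
  -- adapted from x11b `exists_modularParametrizationData_not_dvd` (BDPRouteManin.lean)
  have hp : p.Prime := Fact.out
  haveI : (W.baseChange ℂ).IsElliptic := by rw [WeierstrassCurve.baseChange]; infer_instance
  -- the optimal curve `W₀ ~ W` of the class, with its datum `D₀` of minimal degree
  obtain ⟨W₀, hW₀, hW₀min, D₀, hfW, hisoW, hmin⟩ :=
    exists_optimal_modularParametrizationData_of_modularity hnf (W.conductorNorm ℤ) W rfl
  haveI := hW₀
  haveI := hW₀min
  -- minimal degree forces lattice-optimality `Λ_{W₀} = c₀ Λ_f`
  obtain ⟨W₁, hW₁, D₁, hf₁, h₁⟩ := D₀.exists_optimalDatum'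
  haveI := hW₁
  have hopt : ∀ z ∈ D₀.L.lattice, ∃ w ∈ periodLattice D₀.f, z = D₀.c * w :=
    D₀.latticeEq_of_modularDegree_le D₁ hf₁ h₁ (hmin W₁ D₁ hf₁)
  -- the optimal curve lies on the cell (isogeny invariance), and has the same conductor
  have hc2₀ : N10.CellGordTwo W₀ p := by
    -- (lane A's `N10.cellGordTwo_of_isIsogenous`, inlined from the route-independent `GordIsogenyInvariance`)
    obtain ⟨hp2, hadd, hG, he⟩ := hc2
    exact ⟨hp2, Addv.of_isIsogenous_of_typeG hadd hG.typeG hisoW, hG.of_isIsogenous hp2 hadd hisoW,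
      (semistabilityIndex_eq_of_isIsogenous_of_typeG_of_addv hp2 hadd hG.typeG hisoW).trans he⟩
  have hN₀ : W₀.conductorNorm ℤ = W.conductorNorm ℤ :=
    (conductorNorm_eq_of_isIsogenous_of_modularity_of_isGloballyMinimal hmodP hisoW).symm
  -- Edixhoven 1991 Thm. 3 on the cell: `p ∤ c₀`
  have hc₀ : ¬ (p : ℤ) ∣ D₀.c := by
    have aux : ∀ (N' : ℕ) [NeZero N'] (hN' : W₀.conductorNorm ℤ = N')
        (D' : ModularParametrizationData W₀ N'),
        (∀ z ∈ D'.L.lattice, ∃ w ∈ periodLattice D'.f, z = D'.c * w) → ¬ (p : ℤ) ∣ D'.maninConstant := by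
      intro N' _ hN' D' hopt'
      subst hN'
      exact Addv.not_dvd_maninConstant_of_semistabilityIndex_dvd_two W₀ p hEdxK D' hopt' hp7 hc2₀.2.1
        (by rw [hc2₀.2.2.2])
    exact aux (W.conductorNorm ℤ) hN₀ D₀ hopt
  -- an integral multiplier `k : Λ_{W₀} → Λ_W` prime to `p`
  obtain ⟨LW, hLW⟩ := exists_isNeronLatticeOf_holds (W.baseChange ℂ)
  obtain ⟨k, hk0, hpk, hk⟩ :=
    exists_int_mul_mem_lattice_not_dvd hNS hisoW.symm_of_charZero D₀.isNeronLattice hLW hp hirr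
  -- the datum `(f, Λ_W, k c₀)` of `W`
  have hm0 : k * D₀.c ≠ 0 := mul_ne_zero hk0 D₀.maninConstant_ne_zero_holds
  have hle : ∀ z ∈ periodLattice D₀.f, ((k * D₀.c : ℤ) : ℂ) * z ∈ LW.lattice := fun z hz ↦ by
    have h2 := hk _ (D₀.smul_periodLattice_le z hz)
    rwa [← mul_assoc, ← Int.cast_mul] at h2
  obtain ⟨D, -, -, hDc⟩ := ModularParametrizationData.exists_of_isNewformOf hfW hLW hm0 hle
  refine ⟨D, fun hdvd ↦ ?_⟩
  rw [hDc] at hdvd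
  rcases (Nat.prime_iff_prime_int.mp hp).dvd_or_dvd hdvd with h | h
  · exact hpk h
  · exact hc₀ h

/-- **The Manin-unit Heegner datum on the cell at `p ≥ 11`.** For every globally minimal elliptic `W/ℚ`,
every pair of cell (G-ord, `e = 2`) with `7 < p` and `E[p]` irreducible, and every imaginary quadratic `K`
satisfying the Heegner hypothesis for the conductor: a datum `Dt` at the conductor level with `p ∤ c`, a
Heegner datum `H` of discriminant `d_K` (Gross 1984 §I.1), an embedding `ι : K → ℂ`, and a point `P ∈ E(K)`
mapping to the Heegner point (Darmon 2004 Thm. 3.6) — x11b's `exists_maninDatum` with Edixhoven in place of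
Mazur. [cite: EdixhovenManin1991, Thm. 3] [cite: Darmon2004, Thm. 3.6 and §3.7] -/
theorem exists_maninDatum_of_cellGordTwo (hnf : exists_isNewformOf)
    (hmodP : nonempty_modularParametrizationData)
    (hEdxK : edixhoven_not_dvd_maninConstant_of_kodairaSymbol_ne)
    (hNS : integral_neronScaling_of_isGloballyMinimal)
    (W : WeierstrassCurve ℚ) [W.IsElliptic] [W.IsGloballyMinimal] [NeZero (W.conductorNorm ℤ)]
    (p : ℕ) [Fact p.Prime] (K : Type) [Field K] [NumberField K]
    (hc2 : N10.CellGordTwo W p) (hp7 : 7 < p) (hirr : W.HasIrreducibleModPGaloisRep p)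
    (hK : IsImaginaryQuadratic K) (hH : SatisfiesHeegnerHypothesis (W.conductorNorm ℤ) K) :
    ∃ (Dt : ModularParametrizationData W (W.conductorNorm ℤ))
      (H : HeegnerDatum (W.conductorNorm ℤ) (NumberField.discr K))
      (ι : K →+* ℂ) (P : (W.baseChange K).toAffine.Point),
      WeierstrassCurve.Affine.Point.map ι.toRatAlgHom P = heegnerPointComplex Dt H ∧
        ¬ (p : ℤ) ∣ Dt.c := by
  obtain ⟨Dt, hDt⟩ :=
    exists_modularParametrizationData_not_dvd_of_cellGordTwo hnf hmodP hEdxK hNS W p hc2 hp7 hirr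
  obtain ⟨β, hβ⟩ := exists_dvd_sq_sub_discr_holds (W.conductorNorm ℤ) K hK hH
  obtain ⟨H, -⟩ := nonempty_heegnerDatum_holds (W.conductorNorm ℤ) K hK hβ
  obtain ⟨ι⟩ : Nonempty (K →+* ℂ) := inferInstance
  obtain ⟨P, hP⟩ := heegnerPointComplex_mem_range_map_holds (W.conductorNorm ℤ) W K hK hH Dt H ι
  exact ⟨Dt, H, ι, P, hP, hDt⟩

/-! ### §5 CLASS LEVEL: the crux on the tower-surjective rows of the cell from PUBLISHED facts + STEP L_add -/

/-- **Crux `GordTwoRankOne` (item 19358) on every tower-surjective pair of cell (G-ord, `e = 2`), from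
PUBLISHED facts and ONE STEP-L-shaped input** (the Jetchev–Skinner–Wan 2017 §7.4.1 LOWER-half assembly run
at an additive prime; x11b's `missingLowerBoundAt_of_classX11b_of_ram` with the multiplicative prime replaced
by an additive potentially good one). PUBLISHED binders: Gross–Zagier `hGZ`, Kolyvagin (qualitative) `hKo`,
Kato 2004 Thm. 14.5 (3) Tamagawa-exact at an additive potentially good prime `hKatoT` (for the rank-`0`
TWIST), GZK `hGZK`, modularity `hmod`/`hnf`/`hmodP`, Friedberg–Hoffstein `hFH` (the auxiliary field: every
`ℓ ∣ N` split, `|d_K| > 4`, `L(E^{d_K},1) ≠ 0`), Edixhoven 1991 Thm. 3 `hEdxK` and the Néron mapping property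
`hNS` (the Manin-unit datum at `p ≥ 11`). RIDER `hMan7`: at `p ∈ {3,5,7}` a Manin-unit Heegner datum (Cremona's
`c = 1` per optimal curve in the tables; no class-level theorem in print at an additive `p ≤ 7`). THE TYPED
INPUT `hL` — STEP L_add: `X11b.IndexLowerBoundAt W p K P` at every Manin-good Heegner datum of such a pair,
granted finiteness of `Ш(E/K)` — OPEN at an additive prime (in print it is "one divisibility of the
anticyclotomic main conjecture + BDP formula" / W. Zhang's `p`-indivisibility of the Kolyvagin system, both
only at `p ∤ N`). CONCLUSION: for every globally minimal `E/ℚ` with `ord_{s=1}L(E,s) = 1`, every pair of the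
cell with `ρ̄_{E,p^n}` onto for all `n`: `ord_p #Ш(E)_an ≤ ord_p #Ш(E)` (`Typed.MissingLowerBoundAt`). No
Λ-adic branch object, no `p`-adic height / Schneider / `A′`, no Tamagawa condition, `p = 3` allowed. Nothing
is booked; the crux stays OPEN. [cite: JetchevSkinnerWan2017, §7.4.1 (pp. 29–31)]
[cite: Kato2004Asterisque, Thm. 14.5 (3) (p. 236)] [cite: EdixhovenManin1991, Thm. 3] [cite: Miller2011LMS, Def. 1.1] -/
theorem cellGordTwo_missingLowerBoundAt_rankOne_of_towerSurj_of_indexLowerBoundAt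
    -- published inputs (named facts of the tree)
    (hGZ : ∀ (N : ℕ) [NeZero N] (W : WeierstrassCurve ℚ) (K : Type) [Field K] [NumberField K],
      gross_zagier N W K)
    (hKo : ∀ (N : ℕ) [NeZero N] (W : WeierstrassCurve ℚ) (K : Type) [Field K] [NumberField K],
      kolyvagin N W K)
    (hKatoT : Kato2004.rankZero_padicValNat_sha_add_padicValNat_tamagawa_le_of_additive_potGood_of_imageContainsSL2)
    (hGZK : rank_eq_analyticRank_of_analyticRank_le_one) (hmod : hasEntireLFunction_rat)
    (hnf : exists_isNewformOf) (hmodP : nonempty_modularParametrizationData)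
    (hFH : friedbergHoffstein_exists_heegnerField_split_twist_ne_zero)
    (hEdxK : edixhoven_not_dvd_maninConstant_of_kodairaSymbol_ne)
    (hNS : integral_neronScaling_of_isGloballyMinimal)
    -- rider: a Manin-unit Heegner datum at `p ≤ 7`
    (hMan7 : ∀ (W : WeierstrassCurve ℚ) [W.IsElliptic] [W.IsGloballyMinimal] [NeZero (W.conductorNorm ℤ)]
      (p : ℕ) [Fact p.Prime] (K : Type) [Field K] [NumberField K],
      W.analyticRank = 1 → N10.CellGordTwo W p → (∀ n : ℕ, W.HasSurjectiveModNGaloisRep (p ^ n : ℕ)) →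
      p ≤ 7 → IsImaginaryQuadratic K → SatisfiesHeegnerHypothesis (W.conductorNorm ℤ) K →
      ∃ (Dt : ModularParametrizationData W (W.conductorNorm ℤ))
        (H : HeegnerDatum (W.conductorNorm ℤ) (NumberField.discr K))
        (ι : K →+* ℂ) (P : (W.baseChange K).toAffine.Point),
        WeierstrassCurve.Affine.Point.map ι.toRatAlgHom P = heegnerPointComplex Dt H ∧ ¬ (p : ℤ) ∣ Dt.c)
    -- the typed input of the road (STEP L_add), at every Manin-good Heegner datum
    (hL : ∀ (W : WeierstrassCurve ℚ) [W.IsElliptic] [W.IsGloballyMinimal] (p : ℕ) [Fact p.Prime]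
      (N : ℕ) [NeZero N] (K : Type) [Field K] [NumberField K]
      (Dt : ModularParametrizationData W N) (H : HeegnerDatum N (NumberField.discr K)) (ι : K →+* ℂ)
      (P : (W.baseChange K).toAffine.Point),
      W.analyticRank = 1 → N10.CellGordTwo W p → (∀ n : ℕ, W.HasSurjectiveModNGaloisRep (p ^ n : ℕ)) →
      W.conductorNorm ℤ = N → IsImaginaryQuadratic K → SatisfiesHeegnerHypothesis N K →
      WeierstrassCurve.Affine.Point.map ι.toRatAlgHom P = heegnerPointComplex Dt H →
      ¬ (p : ℤ) ∣ Dt.c → Finite (W.baseChange K).sha → IndexLowerBoundAt W p K P) :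
    ∀ (W : WeierstrassCurve ℚ) [W.IsElliptic] [W.IsGloballyMinimal] (p : ℕ) [Fact p.Prime],
      W.analyticRank = 1 → N10.CellGordTwo W p →
      (∀ n : ℕ, W.HasSurjectiveModNGaloisRep (p ^ n : ℕ)) → Typed.MissingLowerBoundAt W p := by
  intro W _ _ p _ hr hc2 hsurj
  have hp : p.Prime := Fact.out
  obtain ⟨hp2, hadd, hG, he⟩ := hc2
  haveI : NeZero (W.conductorNorm ℤ) := ⟨(W.conductorNorm_pos_holds).ne'⟩
  -- potentially good: `0 ≤ ord_p j`
  have hj : 0 ≤ padicValRat p W.j := not_lt.mp (N10.not_potMult_of_typeGOrd W p hp2 hadd hG)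
  -- irreducible `E[p]` (level `n = 1` of the tower)
  have hirr : W.HasIrreducibleModPGaloisRep p := by
    haveI : NeZero (p : ℚ) := ⟨by exact_mod_cast hp.ne_zero⟩
    exact hasIrreducibleModPGaloisRep_of_hasSurjectiveModNGaloisRep W p (by simpa using hsurj 1)
  -- the sign of the functional equation is `−1` (modularity, `r_an = 1`)
  have hw : W.rootNumber = -1 := by
    rw [WeierstrassCurve.rootNumber_eq_neg_one_pow_analyticRank_of_exists_isNewformOf hnf W, hr]
    norm_num
  -- the auxiliary field (Friedberg–Hoffstein): every `ℓ ∣ N` split, `|d_K| > 4`, `L(E^{d_K},1) ≠ 0`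
  obtain ⟨K, _, _, hK, hdisc, hHN, -, hLt⟩ := hFH W hw p hp 4
  -- `w_K = 2`, prime to the odd prime `p`
  have hμ : ¬ p ∣ Units.torsionOrder K := by
    haveI : IsTotallyComplex K := hK.2
    have hneg : NumberField.discr K < 0 := discr_neg_of_finrank_eq_two K hK.1
    have habs : ((NumberField.discr K).natAbs : ℤ) = -NumberField.discr K :=
      Int.ofNat_natAbs_of_nonpos hneg.le
    have h4 : NumberField.discr K < -4 := by
      have : (4 : ℤ) < ((NumberField.discr K).natAbs : ℤ) := by exact_mod_cast hdisc
      omega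
    rw [Literature.NumberTheory.DiophantineGeometry.torsionOrder_eq_two_of_discr_lt hK.1 h4]
    intro h2
    have := Nat.le_of_dvd two_pos h2
    have h2le : 2 ≤ p := hp.two_le
    omega
  -- the Manin-unit Heegner datum: Edixhoven at `p ≥ 11`, the rider at `p ≤ 7`
  obtain ⟨Dt, H, ι, P, hP, hc⟩ : ∃ (Dt : ModularParametrizationData W (W.conductorNorm ℤ))
      (H : HeegnerDatum (W.conductorNorm ℤ) (NumberField.discr K))
      (ι : K →+* ℂ) (P : (W.baseChange K).toAffine.Point),
      WeierstrassCurve.Affine.Point.map ι.toRatAlgHom P = heegnerPointComplex Dt H ∧ ¬ (p : ℤ) ∣ Dt.c := by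
    by_cases hp7 : 7 < p
    · exact exists_maninDatum_of_cellGordTwo hnf hmodP hEdxK hNS W p K ⟨hp2, hadd, hG, he⟩ hp7 hirr hK hHN
    · exact hMan7 W p K hr ⟨hp2, hadd, hG, he⟩ hsurj (not_lt.mp hp7) hK hHN
  -- a globally minimal model of the twist (Néron; Silverman VIII.8 Cor. 8.3)
  have hD0 : (NumberField.discr K : ℚ) ≠ 0 := by exact_mod_cast NumberField.discr_ne_zero K
  haveI hEt : (W.quadraticTwist (NumberField.discr K : ℚ)).IsElliptic :=
    W.isElliptic_quadraticTwist hD0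
  obtain ⟨Cd, hCd⟩ := hasGlobalMinimalModel_rat_holds (W.quadraticTwist (NumberField.discr K : ℚ))
  haveI : (Cd • W.quadraticTwist (NumberField.discr K : ℚ)).IsGloballyMinimal := hCd
  have hWd : Cd • W.quadraticTwist (NumberField.discr K : ℚ) =
      Cd • W.quadraticTwist (NumberField.discr K : ℚ) := rfl
  exact missingLowerBoundAt_rankOne_additive_of_indexLowerBoundAt W p K Dt H ι P (hGZ _ W K) (hKo _ W K)
    hKatoT hGZK hmod hr hp2 hadd hj hsurj hK hHN hP hc hμ hLt
    (Cd • W.quadraticTwist (NumberField.discr K : ℚ)) Cd hWd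
    (hL W p _ K Dt H ι P hr ⟨hp2, hadd, hG, he⟩ hsurj rfl hK hHN hP hc)

end Summit.BirchSwinnertonDyer.BirchSwinnertonDyer.Theorems.AdditiveBranchIMCGordTwoRankOne.HeegnerKolyvagin

end
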